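import Summits.CriticalPhenomena.PercolationContinuityZ3.Theorems.PercNearOneGluingNoHeavyLowerTailSahiCombTriWPrincipalCor

/-!
# The CO-COVERING GENERATORS stratum: `k ≥ 3` generators with pairwise `g ∪ g' = univ` are antipodally positively correlated (`Cor_P ≥ 0`), hence `TriWIneq`

Support file of the one-cut programme (crux `NoHeavyLowerTail`, stmt-CriticalPhenomena-4575; TRI lane of cell `prim-masterthm`; seat prim-lf-1 gen 40,
memo `FROM-prim-lf-1-gen40-CYLINDER-AND-JSWITCH.md`).  Continuation of `…SahiCombTriWPrincipalCor` (`corP_upGen_eq`: `Cor_{↑g}` = rearrangement + two Kleitman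
gaps), `…SahiCombTriWCorNonneg` (P5 gen 24: `triW_nonneg_of_corP_nonneg`) and `…SahiCombTriWTwoGen` (the case `k = 2`, which needs a join literal).

THEOREM (**`FiveUpSet.corP_coCover_nonneg`**, **`FiveUpSet.triW_nonneg_coCover`**).  Let `G` be a family of `k ≥ 3` subsets of `univ`, none equal to `univ`, with
`g ∪ g' = univ` for all `g ≠ g'` in `G`, and `P = {t | ∃ g ∈ G, g ⊆ t} = ⋃ ↑g`.  Then `Cor_P(A,B) ≥ 0` for all up-sets `A, B` (the constant weight `w ≡ 1` is a
sandwich certificate) and `0 ≤ triW P F G` for every index cube.  For `k = 2` this is FALSE (`Cor_P = −1` rows; `…TriWTwoGen` repairs them with a join literal);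
exact LP data: the classes `↑023∪↑014∪↑1234`, `↑0134∪↑0234∪↑012` of `2^5` have Formula-A certificates; random tests `n = 6, 7` (HOME/code/gen40/lab/kgen_test.py).
PROOF.  `f(s) = δ_A(s)δ_B(s)`, `C_g = Cor_{↑g} = Σ_{s⊇g} f(s) ≥ 0`; every `s ∈ P` other than `univ` lies above EXACTLY ONE generator, so
`Σ_g C_g = Cor_P + (k−1)·f(univ)` (`sum_corP_upGen_eq`).  On non-trivial rows `f(univ) = 1` and `Σ_g C_g ≥ k − 1` by: with `p_g = univ \\ g ⊆ g'` (`g' ≠ g`),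
(F1) `g ∈ A∩B ⟹ C_g ≥ 1`, (F3) `p_g ∉ A ∧ p_g ∉ B ⟹ C_g ≥ 1` (rearrangement piece at `g`, resp. `univ`), (F4) `g ∈ A ∧ p_g ∉ B ⟹ C_g ≥ 1` (all terms of
`Σ_{s⊇g} f` are `≥ 0`, the top one is `1`), (F2) `p_g ∈ A ⟹ g' ∈ A`; hence two generators with `C = 0` force every other one to have `C ≥ 2`, and three are impossible.
HONEST LABEL: complete proofs, std axioms; a new unconditional stratum of `TriWIneq` (all `n`, all `a`); `TriWIneq` itself stays OPEN. [this work]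
-/

namespace Summit.CriticalPhenomena.PercolationContinuityZ3.Theorems

namespace FiveUpSet

open Finset

variable {β γ : Type} [DecidableEq β] [Fintype β] [DecidableEq γ] [Fintype γ]

/-! ### Lower bounds for `Cor_{↑g}` -/

omit [DecidableEq β] [Fintype β] in
/-- Any sub-family of the rearrangement piece bounds `Cor_{↑g}` from below. [this work] -/
theorem card_le_corP_upGen {g : Finset γ} {A B : Finset (Finset γ)} (hA : IsUpperSet (A : Set (Finset γ))) (hB : IsUpperSet (B : Set (Finset γ)))
    {S : Finset (Finset γ)} (hS : S ⊆ upGen g ∩ (A \ loTr g A) ∩ (B \ loTr g B)) : (S.card : ℤ) ≤ corP (upGen g) A B := by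
  rw [corP_upGen_eq g hA hB]
  have hAg : IsUpperSet ((A ∩ upGen g : Finset (Finset γ)) : Set (Finset γ)) := by rw [coe_inter]; exact hA.inter (isUpperSet_upGen g)
  have hBg : IsUpperSet ((B ∩ upGen g : Finset (Finset γ)) : Set (Finset γ)) := by rw [coe_inter]; exact hB.inter (isUpperSet_upGen g)
  have k1 := card_inter_refl_le hAg (isUpperSet_loTr g hB)
  have k2 := card_refl_inter_le hBg (isUpperSet_loTr g hA)
  have k1' : ((A ∩ upGen g ∩ refl (loTr g B)).card : ℤ) ≤ (A ∩ upGen g ∩ loTr g B).card := by exact_mod_cast k1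
  have k2' : ((refl (loTr g A) ∩ (B ∩ upGen g)).card : ℤ) ≤ (loTr g A ∩ (B ∩ upGen g)).card := by exact_mod_cast k2
  have k0 : (S.card : ℤ) ≤ (upGen g ∩ (A \ loTr g A) ∩ (B \ loTr g B)).card := by exact_mod_cast card_le_card hS
  linarith

omit [DecidableEq β] [Fintype β] in
/-- Membership in the rearrangement piece, unfolded. [this work] -/
theorem mem_rearr {g s : Finset γ} {A B : Finset (Finset γ)} (hg : g ⊆ s) (hsA : s ∈ A) (hsA' : s \ g ∉ A) (hsB : s ∈ B) (hsB' : s \ g ∉ B) :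
    s ∈ upGen g ∩ (A \ loTr g A) ∩ (B \ loTr g B) := by
  simp only [mem_inter, mem_sdiff, mem_upGen, mem_loTr]
  exact ⟨⟨hg, hsA, hsA'⟩, hsB, hsB'⟩

omit [DecidableEq β] [Fintype β] in
/-- (F4) `g ∈ A`, `univ \ g ∉ B`, `univ ∈ B`, `∅ ∉ A` ⟹ `Cor_{↑g}(A,B) ≥ 1`: every term of `Σ_{s ⊇ g} δ_A(s)δ_B(s)` is `≥ 0` and the top term is `1`. [this work] -/
theorem one_le_corP_upGen_of_mem {g : Finset γ} {A B : Finset (Finset γ)} (hA : IsUpperSet (A : Set (Finset γ))) (hB : IsUpperSet (B : Set (Finset γ)))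
    (hgA : g ∈ A) (hpB : univ \ g ∉ B) (hWB : (univ : Finset γ) ∈ B) (h0A : (∅ : Finset γ) ∉ A) : 1 ≤ corP (upGen g) A B := by
  rw [corP_eq_sum]
  have hnonneg : ∀ s ∈ upGen g, 0 ≤ sgnDiff A (refl A) s * sgnDiff B (refl B) s := by
    intro s hs
    rw [mem_upGen] at hs
    have hsA : s ∈ A := hA hs hgA
    have hscB : sᶜ ∉ B := fun h => hpB (hB (by rw [compl_eq_univ_sdiff]; exact sdiff_subset_sdiff le_rfl hs) h)
    unfold sgnDiff
    by_cases h1 : sᶜ ∈ A <;> by_cases h2 : s ∈ B <;> simp [mem_refl, hsA, hscB, h1, h2]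
  have htop : sgnDiff A (refl A) univ * sgnDiff B (refl B) univ = 1 := by
    unfold sgnDiff
    have h0B : (∅ : Finset γ) ∉ B := fun h => hpB (hB (empty_subset _) h)
    have hWA : (univ : Finset γ) ∈ A := hA (subset_univ g) hgA
    simp [mem_refl, compl_univ, hWA, hWB, h0A, h0B]
  have := Finset.single_le_sum hnonneg (mem_upGen.2 (subset_univ g))
  rw [htop] at this
  exact this

/-! ### The sum of the principal correlations over the generators -/

omit [DecidableEq β] [Fintype β] in
/-- **`Σ_{g∈G} Cor_{↑g} = Cor_P + (k−1)·δ_A(univ)δ_B(univ)`** for pairwise co-covering generators. [this work] -/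
theorem sum_corP_upGen_eq (G : Finset (Finset γ)) (hco : ∀ g ∈ G, ∀ g' ∈ G, g ≠ g' → g ∪ g' = univ) (hG : G.Nonempty)
    (P : Finset (Finset γ)) (hP : ∀ t, t ∈ P ↔ ∃ g ∈ G, g ⊆ t) (A B : Finset (Finset γ)) :
    ∑ g ∈ G, corP (upGen g) A B = corP P A B + ((G.card : ℤ) - 1) * (sgnDiff A (refl A) univ * sgnDiff B (refl B) univ) := by
  set f : Finset γ → ℤ := fun s => sgnDiff A (refl A) s * sgnDiff B (refl B) s with hf
  have hWP : (univ : Finset γ) ∈ P := by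
    obtain ⟨g, hg⟩ := hG; exact (hP univ).2 ⟨g, hg, subset_univ g⟩
  have h1 : ∀ g ∈ G, corP (upGen g) A B = f univ + ∑ s ∈ (upGen g).erase univ, f s := by
    intro g _
    rw [corP_eq_sum, ← Finset.add_sum_erase (upGen g) f (mem_upGen.2 (subset_univ g))]
  rw [Finset.sum_congr rfl h1, sum_add_distrib, sum_const, nsmul_eq_mul]
  have hdisj : (↑G : Set (Finset γ)).PairwiseDisjoint (fun g => (upGen g).erase univ) := by
    intro g hg g' hg' hne
    rw [Function.onFun, disjoint_left]
    intro s hs hs'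
    rw [mem_erase, mem_upGen] at hs hs'
    have : univ ⊆ s := by rw [← hco g hg g' hg' hne]; exact union_subset hs.2 hs'.2
    exact hs.1 (eq_univ_of_forall fun x => this (mem_univ x))
  have hcover : P.erase univ = G.biUnion (fun g => (upGen g).erase univ) := by
    ext s
    rw [mem_erase, mem_biUnion, hP]
    constructor
    · rintro ⟨hne, g, hg, hgs⟩; exact ⟨g, hg, mem_erase.2 ⟨hne, mem_upGen.2 hgs⟩⟩
    · rintro ⟨g, hg, hs⟩; rw [mem_erase, mem_upGen] at hs; exact ⟨hs.1, g, hg, hs.2⟩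
  have h2 : corP P A B = f univ + ∑ s ∈ P.erase univ, f s := by
    rw [corP_eq_sum, ← Finset.add_sum_erase P f hWP]
  rw [h2, hcover, Finset.sum_biUnion hdisj]
  ring

/-! ### The theorem -/

omit [DecidableEq β] [Fintype β] in
/-- **`Cor_P ≥ 0` for `k ≥ 3` pairwise co-covering generators** (none equal to `univ`). [this work] -/
theorem corP_coCover_nonneg (G : Finset (Finset γ)) (hk : 3 ≤ G.card) (hco : ∀ g ∈ G, ∀ g' ∈ G, g ≠ g' → g ∪ g' = univ)
    (hnu : ∀ g ∈ G, g ≠ univ) (P : Finset (Finset γ)) (hP : ∀ t, t ∈ P ↔ ∃ g ∈ G, g ⊆ t)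
    {A B : Finset (Finset γ)} (hA : IsUpperSet (A : Set (Finset γ))) (hB : IsUpperSet (B : Set (Finset γ))) : 0 ≤ corP P A B := by
  have hG : G.Nonempty := card_pos.1 (by omega)
  have hsum := sum_corP_upGen_eq G hco hG P hP A B
  have hC : ∀ g ∈ G, 0 ≤ corP (upGen g) A B := fun g _ => corP_upGen_nonneg g hA hB
  have hk3 : (3 : ℤ) ≤ G.card := by exact_mod_cast hk
  have hk1 : (0 : ℤ) ≤ (G.card : ℤ) - 1 := by linarith
  by_cases htriv : (univ : Finset γ) ∈ A ∧ (∅ : Finset γ) ∉ A ∧ (univ : Finset γ) ∈ B ∧ (∅ : Finset γ) ∉ B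
  swap
  · -- trivial rows: the top sign product is `≤ 0`
    have hs : sgnDiff A (refl A) univ * sgnDiff B (refl B) univ ≤ 0 := by
      have e0A : (∅ : Finset γ) ∈ A → (univ : Finset γ) ∈ A := fun h => hA (empty_subset _) h
      have e0B : (∅ : Finset γ) ∈ B → (univ : Finset γ) ∈ B := fun h => hB (empty_subset _) h
      unfold sgnDiff
      simp only [mem_refl, compl_univ]
      by_cases a1 : (univ : Finset γ) ∈ A <;> by_cases a0 : (∅ : Finset γ) ∈ A <;> by_cases b1 : (univ : Finset γ) ∈ B <;>
        by_cases b0 : (∅ : Finset γ) ∈ B <;> (simp [a1, a0, b1, b0] at htriv ⊢; try tauto)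
    have := sum_nonneg hC
    nlinarith
  obtain ⟨hWA, h0A, hWB, h0B⟩ := htriv
  have hs1 : sgnDiff A (refl A) univ * sgnDiff B (refl B) univ = 1 := by
    unfold sgnDiff; simp [mem_refl, compl_univ, hWA, hWB, h0A, h0B]
  rw [hs1, mul_one] at hsum
  suffices hmain : (G.card : ℤ) - 1 ≤ ∑ g ∈ G, corP (upGen g) A B by linarith
  -- the facts
  have F1 : ∀ g ∈ G, g ∈ A → g ∈ B → 1 ≤ corP (upGen g) A B := by
    intro g _ hgA hgB
    have h := card_le_corP_upGen hA hB (S := {g}) (singleton_subset_iff.2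
      (mem_rearr le_rfl hgA (by rw [sdiff_self]; exact h0A) hgB (by rw [sdiff_self]; exact h0B)))
    rwa [card_singleton] at h
  have F3 : ∀ g ∈ G, univ \ g ∉ A → univ \ g ∉ B → 1 ≤ corP (upGen g) A B := by
    intro g _ hpA hpB
    have h := card_le_corP_upGen hA hB (S := {univ}) (singleton_subset_iff.2 (mem_rearr (subset_univ g) hWA hpA hWB hpB))
    rwa [card_singleton] at h
  have hsub : ∀ g ∈ G, ∀ g' ∈ G, g ≠ g' → univ \ g ⊆ g' := by
    intro g hg g' hg' hne x hx
    rw [mem_sdiff] at hx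
    have : x ∈ g ∪ g' := by rw [hco g hg g' hg' hne]; exact mem_univ x
    rcases mem_union.1 this with h' | h'
    · exact absurd h' hx.2
    · exact h'
  have F2A : ∀ g ∈ G, ∀ g' ∈ G, g ≠ g' → univ \ g ∈ A → g' ∈ A := fun g hg g' hg' hne h => hA (hsub g hg g' hg' hne) h
  have F2B : ∀ g ∈ G, ∀ g' ∈ G, g ≠ g' → univ \ g ∈ B → g' ∈ B := fun g hg g' hg' hne h => hB (hsub g hg g' hg' hne) h
  have F4 : ∀ g ∈ G, g ∈ A → univ \ g ∉ B → 1 ≤ corP (upGen g) A B := fun g _ hgA hpB => one_le_corP_upGen_of_mem hA hB hgA hpB hWB h0A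
  have F4' : ∀ g ∈ G, g ∈ B → univ \ g ∉ A → 1 ≤ corP (upGen g) A B := by
    intro g _ hgB hpA; rw [corP_comm]; exact one_le_corP_upGen_of_mem hB hA hgB hpA hWA h0B
  have R2 : ∀ g ∈ G, g ∈ A → g ∈ B → univ \ g ∉ A → univ \ g ∉ B → 2 ≤ corP (upGen g) A B := by
    intro g hg hgA hgB hpA hpB
    have hsub2 : ({g, univ} : Finset (Finset γ)) ⊆ upGen g ∩ (A \ loTr g A) ∩ (B \ loTr g B) := by
      intro s hs
      rw [mem_insert, mem_singleton] at hs
      rcases hs with rfl | rfl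
      · exact mem_rearr le_rfl hgA (by rw [sdiff_self]; exact h0A) hgB (by rw [sdiff_self]; exact h0B)
      · exact mem_rearr (subset_univ _) hWA hpA hWB hpB
    have h := card_le_corP_upGen hA hB hsub2
    rwa [card_pair (hnu g hg)] at h
  -- profile of a 'bad' generator (`C = 0`): `p ∈ A, g ∉ A, g ∈ B? ...`; we only need the following consequence:
  -- bad g ⟹ (p_g ∈ A ∧ g ∉ A ∧ p_g ∉ B) ∨ (p_g ∈ B ∧ g ∉ B ∧ p_g ∉ A) ∨ (p_g ∈ A ∧ p_g ∈ B)
  have bad : ∀ g ∈ G, corP (upGen g) A B = 0 →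
      (univ \ g ∈ A ∧ g ∉ A ∧ univ \ g ∉ B) ∨ (univ \ g ∈ B ∧ g ∉ B ∧ univ \ g ∉ A) ∨ (univ \ g ∈ A ∧ univ \ g ∈ B) := by
    intro g hg h0
    by_cases hpA : univ \ g ∈ A <;> by_cases hpB : univ \ g ∈ B
    · exact Or.inr (Or.inr ⟨hpA, hpB⟩)
    · refine Or.inl ⟨hpA, fun hgA => ?_, hpB⟩
      linarith [F4 g hg hgA hpB]
    · refine Or.inr (Or.inl ⟨hpB, fun hgB => ?_, hpA⟩)
      linarith [F4' g hg hgB hpA]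
    · linarith [F3 g hg hpA hpB]
  -- Σ over G with one point removed
  have sum_ge_of_one : ∀ i ∈ G, (∀ g ∈ G, g ≠ i → 1 ≤ corP (upGen g) A B) → (G.card : ℤ) - 1 ≤ ∑ g ∈ G, corP (upGen g) A B := by
    intro i hi hrest
    rw [← Finset.add_sum_erase G _ hi]
    have h1 : ∑ g ∈ G.erase i, (1 : ℤ) ≤ ∑ g ∈ G.erase i, corP (upGen g) A B :=
      sum_le_sum fun g hg => hrest g (mem_of_mem_erase hg) (ne_of_mem_erase hg)
    rw [sum_const, nsmul_eq_mul, mul_one, card_erase_of_mem hi] at h1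
    have hc : ((G.card - 1 : ℕ) : ℤ) = (G.card : ℤ) - 1 := by
      have : 1 ≤ G.card := by omega
      push_cast [Nat.cast_sub this]; ring
    rw [hc] at h1
    linarith [hC i hi]
  -- case analysis on the number of bad generators
  by_cases hnone : ∀ g ∈ G, 1 ≤ corP (upGen g) A B
  · obtain ⟨i, hi⟩ := hG
    exact sum_ge_of_one i hi (fun g hg _ => hnone g hg)
  push Not at hnone
  obtain ⟨i, hi, hCi⟩ := hnone
  have hCi0 : corP (upGen i) A B = 0 := le_antisymm (by linarith) (hC i hi)
  by_cases hone : ∀ g ∈ G, g ≠ i → 1 ≤ corP (upGen g) A B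
  · exact sum_ge_of_one i hi hone
  push Not at hone
  obtain ⟨j, hj, hji, hCj⟩ := hone
  have hCj0 : corP (upGen j) A B = 0 := le_antisymm (by linarith) (hC j hj)
  -- two bad generators `i ≠ j`: derive their profile
  have hij : i ≠ j := fun h => hji h.symm
  have key : ∀ {a b : Finset γ}, a ∈ G → b ∈ G → a ≠ b → corP (upGen a) A B = 0 → corP (upGen b) A B = 0 →
      ¬ (univ \ a ∈ A ∧ univ \ a ∈ B) := by
    intro a b ha hb hne h0a h0b ⟨hpA, hpB⟩
    have hbA := F2A a ha b hb hne hpA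
    have hbB := F2B a ha b hb hne hpB
    linarith [F1 b hb hbA hbB]
  -- profiles: each of i, j has its `p` in exactly one of A, B, and not the same one
  have pi := bad i hi hCi0
  have pj := bad j hj hCj0
  have npi := key hi hj hij hCi0 hCj0
  have npj := key hj hi hji hCj0 hCi0
  -- every other generator has `C ≥ 2`
  have others : ∀ l ∈ G, l ≠ i → l ≠ j → 2 ≤ corP (upGen l) A B := by
    intro l hl hli hlj
    rcases pi with ⟨hpiA, hgiA, hpiB⟩ | ⟨hpiB, hgiB, hpiA⟩ | hboth
    · -- p_i ∈ A: then g_j ∈ A, so bad j must have p_j ∈ B (and p_j ∉ A)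
      have hgjA := F2A i hi j hj hij hpiA
      rcases pj with ⟨hpjA, _, _⟩ | ⟨hpjB, hgjB, hpjA⟩ | hboth'
      · exact absurd (F2A j hj i hi hji hpjA) hgiA
      · have hlA := F2A i hi l hl (Ne.symm hli) hpiA
        have hlB := F2B j hj l hl (Ne.symm hlj) hpjB
        have hplA : univ \ l ∉ A := fun h => hgiA (F2A l hl i hi hli h)
        have hplB : univ \ l ∉ B := fun h => hgjB (F2B l hl j hj hlj h)
        exact R2 l hl hlA hlB hplA hplB
      · exact absurd hboth' npj
    · have hgjB := F2B i hi j hj hij hpiB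
      rcases pj with ⟨hpjA, hgjA, hpjB'⟩ | ⟨hpjB, _, _⟩ | hboth'
      · have hlB := F2B i hi l hl (Ne.symm hli) hpiB
        have hlA := F2A j hj l hl (Ne.symm hlj) hpjA
        have hplB : univ \ l ∉ B := fun h => hgiB (F2B l hl i hi hli h)
        have hplA : univ \ l ∉ A := fun h => hgjA (F2A l hl j hj hlj h)
        exact R2 l hl hlA hlB hplA hplB
      · exact absurd (F2B j hj i hi hji hpjB) hgiB
      · exact absurd hboth' npj
    · exact absurd hboth npi
  -- sum ≥ 2(k−2) ≥ k−1
  have hsplit : ∑ g ∈ G, corP (upGen g) A B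
      = corP (upGen i) A B + (corP (upGen j) A B + ∑ g ∈ (G.erase i).erase j, corP (upGen g) A B) := by
    rw [← Finset.add_sum_erase G _ hi, ← Finset.add_sum_erase (G.erase i) _ (mem_erase.2 ⟨hji, hj⟩)]
  have h2 : ∑ g ∈ (G.erase i).erase j, (2 : ℤ) ≤ ∑ g ∈ (G.erase i).erase j, corP (upGen g) A B :=
    sum_le_sum fun g hg => others g (mem_of_mem_erase (mem_of_mem_erase hg)) (ne_of_mem_erase (mem_of_mem_erase hg)) (ne_of_mem_erase hg)
  rw [sum_const, nsmul_eq_mul, card_erase_of_mem (mem_erase.2 ⟨hji, hj⟩), card_erase_of_mem hi] at h2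
  have hc : ((G.card - 1 - 1 : ℕ) : ℤ) = (G.card : ℤ) - 2 := by
    have : 2 ≤ G.card := by omega
    omega
  rw [hc] at h2
  rw [hsplit, hCi0, hCj0]
  linarith

/-- **`TriWIneq` ON THE CO-COVERING GENERATORS STRATUM** (`k ≥ 3` generators, pairwise `g ∪ g' = univ`, none equal to `univ`): `0 ≤ triW P F G` for every
index cube and all monotone families of up-sets, via P5's constant certificate `triW_nonneg_of_corP_nonneg`. [this work] -/
theorem triW_nonneg_coCover (G : Finset (Finset γ)) (hk : 3 ≤ G.card) (hco : ∀ g ∈ G, ∀ g' ∈ G, g ≠ g' → g ∪ g' = univ)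
    (hnu : ∀ g ∈ G, g ≠ univ) (P : Finset (Finset γ)) (hP : ∀ t, t ∈ P ↔ ∃ g ∈ G, g ⊆ t)
    (F G' : Finset β → Finset (Finset γ))
    (hF : ∀ x, IsUpperSet (F x : Set (Finset γ))) (hG : ∀ x, IsUpperSet (G' x : Set (Finset γ)))
    (hFm : Monotone F) (hGm : Monotone G') :
    0 ≤ triW P F G' := by
  have hPup : IsUpperSet (P : Set (Finset γ)) := by
    intro s t hst hs
    rw [mem_coe, hP] at hs ⊢
    obtain ⟨g, hg, hgs⟩ := hs
    exact ⟨g, hg, hgs.trans hst⟩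
  exact triW_nonneg_of_corP_nonneg hPup (fun A B hA hB => corP_coCover_nonneg G hk hco hnu P hP hA hB) F G' hF hG hFm hGm

end FiveUpSet

end Summit.CriticalPhenomena.PercolationContinuityZ3.Theorems
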